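import Summits.HodgeConjecture.HodgeConjecture.Theses.NoetherLefschetzOneUp
import Summits.HodgeConjecture.HodgeConjecture.Theorems.NoetherLefschetzOneUpNetReduction
import Summits.HodgeConjecture.HodgeConjecture.Theorems.NoetherLefschetzOneUpFourfoldsGrantedK3NetsStubGenericGeometricGenus
import Summits.HodgeConjecture.HodgeConjecture.Theorems.NoetherLefschetzOneUpFourfoldsGrantedK3NetsStubVerticalHodgeAlgebraic
import Summits.HodgeConjecture.HodgeConjecture.Theorems.NoetherLefschetzOneUpFourfoldsGrantedK3NetsStubLevelZeroNets
import HarnessLib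

/-!
# Line `birth` — BC3 skeleton for the crux `FourfoldsGrantedK3Nets` (stmt-HodgeConjecture-14599)

Route `NoetherLefschetzOneUp` (route-HodgeConjecture-NoetherLefschetzOneUp), crux #3
`FourfoldsGrantedK3Nets := K3TypeNets → HC(4,2)`, where
`HC(4,2) := ∀ X smooth projective complex fourfold, ∀ c ∈ H⁴(X(ℂ); ℂ) rational of Hodge type (2,2),
c ∈ algebraicClasses X 2` — THE FOURFOLD MIDDLE DEGREE, GRANTED THE K3-TYPE SECTOR (conditional
complement inside dimension 4; open-problem grade by design: granted `K3TypeNets` it is still the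
degree-4 Hodge conjecture for all fourfolds, refuter crux-attacks 2026-08-16, `W2.lean`/`W2g2.lean`).

THE LINE = the route's own NET TRICHOTOMY (route header "How the line reaches it" and TWO-LAYER PLAN:
`FourfoldsGrantedK3Nets ⇐ GeneralTypeNetsTyped + NetTrichotomyGlue(NetReduction ∧ LevelZeroNets ∧
VerticalHodgeAlgebraic)`), registered here as FOUR NAMED PIECES and a kernel-checked composition:

* `stub_genericGeometricGenus : GenericGeometricGenus` — the route's rank-5 item stmt-HodgeConjecture-15374
  BY NAME (generic constancy of `p_g` in a surface net over `ℙ²`: upper semicontinuity, Hartshorne III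
  Thm. 12.8 / Voisin I Cor. 9.19). It is the EXACT open residue of the support item `NetReduction`
  (stmt-11604, every fourfold enters through a net of surfaces of one constant generic geometric genus `g`,
  algebraicity of rational `(2,2)`-classes descending along the blow-down): the landed theorem
  `Theorems.netReduction_of_generic_geometricGenus` (p107363) with the landed net existence
  `Motives.exists_fiberNet_smoothBase_nonempty_holds` turns it into `NetReduction`
  (`netReduction_of_genericGeometricGenus` below, sorry-free). Size M–L.
* `stub_levelZeroNets : LevelZeroNets` — support item stmt-11602 BY NAME, the `g = 0` branch (Arapura 2022
  Cor. 1.5; in tree `Theorems.levelZeroNets_of_deligne_smoothPart`, conditional on the named facts Deligne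
  Hodge III Cor. 8.2.8 and Arapura Thm. 1.2 on the smooth part). Size L.
* `stub_generalTypeNets : <GENERAL-TYPE NETS>` — the `g ≥ 2` branch, verbatim the refuter-vetted text of the
  retired typed crux `GeneralTypeNets` (stmt-HodgeConjecture-11601, closed `moot` at the 2026-08-16 route-repair
  that folded it into this crux; the route's foreseen crux child `GeneralTypeNetsTyped`): for a net
  `f : X ⟶ ℙ²` on a smooth projective fourfold whose fibres off a proper closed `T` are smooth projective
  surfaces with `h^{2,0} ≥ 2`, `span{rational (2,2)} ≤ algebraicClasses X 2 ⊔ span{vertical rational (2,2)}`.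
  INVERSE MUMFORD ONE LEVEL UP: NL curves have expected codimension `p_g ≥ 2 = dim ℙ²` (no density, no
  modular audit), so the supply is `CH₀(X_η)` (multisections) plus sporadic NL-Gysin classes. THE HARDEST STUB,
  open-problem grade: HC(4,2)-equivalent modulo the printed NetReduction (`d ≫ 0` nets have `g ≥ 2`) and
  VerticalHodgeAlgebraic (refuter sandwich `EvidenceLocal.lean` on stmt-11601) — exactly as hard as the crux
  it serves, which is the honest content of a conditional complement; it is NOT cheaply the crux or the
  summit (BC3 probes below: the equivalence needs the two printed theorems and the trichotomy argument).
* `stub_verticalHodgeAlgebraic : VerticalHodgeAlgebraic` — support item stmt-11603 BY NAME: vertical rational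
  `(2,2)`-classes on a netted fourfold are algebraic (Deligne Hodge III 8.2.8 + semisimplicity + Lefschetz
  (1,1) on the threefold `f⁻¹C`; in tree `Theorems.verticalHodgeAlgebraic_of_lefschetzOneOne`, conditional on
  the named facts Deligne 8.2.8 and Voisin 2025 Cor. 2.12, `LefschetzOneOne_holds` landed). Size M.
* `hc42_of_pieces : GenericGeometricGenus → LevelZeroNets → <GENERAL-TYPE NETS> → VerticalHodgeAlgebraic →
  K3TypeNets → HC(4,2)` — the REAL composition (sorry-free, axioms propext / Classical.choice / Quot.sound):
  given a fourfold `X`, `NetReduction` (from piece 1) yields a netted fourfold `X' → ℙ²` with constant generic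
  genus `g` and the transfer `HC(4,2)(X') ⇒ HC(4,2)(X)`; on `X'`, `Nat.lt_trichotomy g 1`: `g = 0` piece 2,
  `g = 1` the crux's hypothesis `K3TypeNets` (the ONLY place the line uses it, and it must: with `K3TypeNets`
  dropped the crux is `HC(4,2)` itself, the `m = 2` instance of the summit), `g ≥ 2` piece 3 — each giving
  `span{rational (2,2)} ≤ algebraic ⊔ vertical`; piece 4 absorbs the vertical summand (`sup_le`).
* `FourfoldsGrantedK3Nets_of : FourfoldsGrantedK3Nets` — THE skeleton theorem: the crux BY NAME from the four
  declared stubs through `hc42_of_pieces` (gate shape: `ledger skeleton check` admits as hypotheses of the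
  crux-concluding theorem only registered obligations by name, so the implication content lives in
  `hc42_of_pieces` and `_of` discharges its hypotheses with the stubs). Its only non-whitelisted axiom is the
  `sorryAx` of the stubs.
* `crux_of_hc42`, `pieces_of_hc42`, `pieces_of_hodgeConjecture` — sorry-free sanity: the crux and the pieces
  2–4 are consequences of `HC(4,2)` resp. of the summit (irrefutable short of a counterexample to the Hodge
  conjecture on a fourfold; piece 1 is a theorem in print), documenting the converse direction of the BC3
  probes.

`sorry` occurs ONLY in `stub_*` theorems. STATUS after wave 1 (lead prover-line-stmt-HodgeConjecture-14599-c1-0,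
2026-08-17): `stub_genericGeometricGenus` LANDED (p145296), `stub_verticalHodgeAlgebraic` LANDED (p145302),
`NetReduction` unconditional + NetTrichotomyGlue landed (`Theorems/NoetherLefschetzOneUpFourfoldsGrantedK3NetsGlue.lean`,
p147452); OPEN: `stub_levelZeroNets` (blocked on the named fact
`Literature.AlgebraicGeometry.HodgeTheory.Arapura2022_thm_1_2_smoothPart_pgZeroSurfaceFibration`, itself reduced in tree
to `FundamentalGroup.riemannExistence_finiteCovering` + `deligne_globalInvariantCycles`, both unproved XL) and
`stub_generalTypeNets` (crux-sized: `Theorems.noetherLefschetzOneUp_generalTypeNets_iff_fourfoldsGrantedK3Nets`).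
STATUS after wave 2 (lead prover-line-stmt-HodgeConjecture-14599-c2-0, 2026-08-17T09:05Z): the conditional closure
`Theorems.stub_levelZeroNets_of_riemannExistence_of_globalInvariantCycles : riemannExistence_finiteCovering →
deligne_globalInvariantCycles → LevelZeroNets` LANDED (p150363, `Theorems/NoetherLefschetzOneUpFourfoldsGrantedK3NetsStubLevelZeroNets.lean`,
Deligne Hodge III 8.2.8 being the tree's theorem `Deligne1974_…_complexGysin_holds` and Arapura's Thm. 1.2 on the
smooth part the tree's `Arapura2022_thm_1_2_smoothPart_pgZeroSurfaceFibration_holds_of_riemannExistence_of_globalInvariantCycles`);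
`stub_levelZeroNets` below is now that helper applied to the two named facts, which are its ONLY `sorry`s — so the
skeleton is CLOSED MODULO {`FundamentalGroup.riemannExistence_finiteCovering` (SGA1 XII 5.1),
`HodgeTheory.deligne_globalInvariantCycles` (Hodge II 4.1.1)} — both in the Literature debt queue, neither `_holds`
exists at 09:00Z — AND `stub_generalTypeNets`, which stays crux-sized: inside this line every fourfold `X` is sent
through the net of `NetReduction` (a fixed-degree `FiberNet` on `Bl_C X`), whose generic genus is `≥ 2` off special
`X`, and the crux hypothesis `K3TypeNets` speaks only of `p_g = 1` nets and cannot be invoked on a `p_g ≥ 2` net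
(`h^{2,0}` of a fibre is model-independent; a closed `T ⊊ ℙ²_ℂ` always misses a `ℂ`-point), so the stub is the rational
Hodge conjecture in degree `4` off the K3-type and level-zero nets (`Theorems.noetherLefschetzOneUp_generalTypeNets_iff_fourfoldsGrantedK3Nets`).

## Disproof used

No `Cruxes/FourfoldsGrantedK3Nets/Disproof.lean` exists at registration (2026-08-17; `ledger crux ls` empty,
payload `disproof_path` absent); `ledger negatives --problem HodgeConjecture` lists no statement bearing on nets
or on HC(4,2). The one structural obstruction on record (refuter `W2g2.lean`: `K3TypeNets → (crux ↔ HC42)`,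
`¬crux ↔ K3TypeNets ∧ ¬HC42`) is honoured: the line USES `K3TypeNets` (at the `g = 1` branch of
`hc42_of_pieces`) and does not claim HC(4,2) off the trichotomy.

## BC3 probes (registrar seat `planner-skel-stmt-HodgeConjecture-14599-0`, folder `bc/probe_*.lean`)

For each stub statement `S ∈ {GenericGeometricGenus, LevelZeroNets, GENERAL-TYPE NETS, VerticalHodgeAlgebraic}`:
`example : S → FourfoldsGrantedK3Nets` and `example : S → HodgeConjecture` by
`first | exact? | simpa | aesop` under `set_option maxHeartbeats 400000` — all 8 must FAIL (results quoted in
`Lines/birth.md` and the seat's NOTES.md).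

## References

* P. Deligne, *The Hodge conjecture*, Clay Mathematics Institute (2000), §1. [Deligne2000]
* D. Arapura, *Hodge cycles and the Leray filtration*, Pacific J. Math. 319 (2022), arXiv:2103.05038,
  Thm. 1.2, Cor. 1.4–1.5. [Arapura2022]
* D. Mumford, *Rational equivalence of 0-cycles on surfaces*, J. Math. Kyoto Univ. 9 (1968). [Mumford1968RatEquiv]
* P. Deligne, *Théorie de Hodge III*, Publ. Math. IHÉS 44 (1974), Cor. 8.2.8. [DeligneHodgeIII1974]
* C. Voisin, *Hodge Theory and Complex Algebraic Geometry I/II* (2002/2003), I Cor. 9.19, Prop. 9.20,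
  Thm. 11.30; II §2.3.1. [VoisinHodgeI2002, VoisinHodgeII2003]
* R. Hartshorne, *Algebraic Geometry* (1977), II Example 7.17.3, III Cor. 10.7, III Thm. 12.8. [Hartshorne1977]
-/

-- `Summit.<Summit>.<Problem>`: for the single-conjunct summit `HodgeConjecture` the duplicate component is mandated.
set_option linter.dupNamespace false
set_option linter.unusedVariables false

noncomputable section

namespace Summit.HodgeConjecture.HodgeConjecture.Cruxes.FourfoldsGrantedK3Nets.Birth

open CategoryTheory AlgebraicGeometry
open Literature.AlgebraicGeometry Literature.AlgebraicGeometry.Motives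
open Literature.AlgebraicGeometry.HodgeTheory
open Summit.HodgeConjecture.HodgeConjecture.Theses.NoetherLefschetzOneUp

/-! ## The statements of the line that are not route items -/

/-- **GENERAL-TYPE NETS** (the `g ≥ 2` branch of the net trichotomy; verbatim the signature of the retired typed
crux `GeneralTypeNets`, stmt-HodgeConjecture-11601, refuter-vetted 2026-08-15): for every smooth projective
complex fourfold `X` and every `f : X ⟶ ℙ²` surjective on points whose fibres over the `ℂ`-points off a proper
Zariski-closed `T ⊊ ℙ²` are smooth projective surfaces admitting a Hodge model with `h^{2,0} ≥ 2`, the span of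
the rational `(2,2)`-classes of `X` lies in `algebraicClasses X 2 ⊔ span{rational (2,2)-classes vanishing on
X ∖ f⁻¹T' for some Zariski-closed T' ⊊ ℙ²}`. [cite: Mumford1968RatEquiv] [cite: Arapura2022, Cor. 1.4] -/
def GeneralTypeNets : Prop :=
  ∀ ⦃X : Literature.AlgebraicGeometry.Motives.SchemeOver ℂ⦄ (f : X ⟶ Literature.AlgebraicGeometry.Motives.projectiveSpace 2 ℂ), Literature.AlgebraicGeometry.Motives.IsSmoothProjective 4 X → Function.Surjective f.left.base → (∃ T : Set (Literature.AlgebraicGeometry.Motives.projectiveSpace 2 ℂ).left, IsClosed T ∧ T ≠ Set.univ ∧ ∀ s : Literature.AlgebraicGeometry.Motives.AlgPoints (Literature.AlgebraicGeometry.Motives.projectiveSpace 2 ℂ) ℂ, s.pt ∉ T → Literature.AlgebraicGeometry.Motives.IsSmoothProjective 2 (Literature.AlgebraicGeometry.Motives.fiberOver f s) ∧ ∃ A : Literature.AlgebraicGeometry.HodgeTheory.HodgeModel 2 (Literature.AlgebraicGeometry.Motives.fiberOver f s), 2 ≤ Module.finrank ℂ ↥(A.hodgePQ 2 2 0)) →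 Submodule.span ℂ {c : Literature.AlgebraicGeometry.HodgeTheory.complexBetti X (2 * 2) | Literature.AlgebraicGeometry.HodgeTheory.IsRationalClass c ∧ Literature.AlgebraicGeometry.HodgeTheory.IsOfHodgeType 4 X (2 * 2) 2 2 c} ≤ Literature.AlgebraicGeometry.HodgeTheory.algebraicClasses X 2 ⊔ Submodule.span ℂ {c : Literature.AlgebraicGeometry.HodgeTheory.complexBetti X (2 * 2) | Literature.AlgebraicGeometry.HodgeTheory.IsRationalClass c ∧ Literature.AlgebraicGeometry.HodgeTheory.IsOfHodgeType 4 X (2 * 2) 2 2 c ∧ ∃ T : Set (Literature.AlgebraicGeometry.Motives.projectiveSpace 2 ℂ).left, IsClosed T ∧ T ≠ Set.univ ∧ Literature.AlgebraicGeometry.HodgeTheory.complexBetti.restrictCompl X (f.left.base ⁻¹' T) (2 * 2) c = 0}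

/-- **HC(4,2)** — the consequent of the crux: every rational `(2,2)`-class on every smooth projective complex
fourfold is algebraic (the `(n,p) = (4,2)` instance of the cycle conjunct of `HodgeConjectureFor`).
[cite: Deligne2000, §1] -/
def HC42 : Prop :=
  ∀ ⦃X : Literature.AlgebraicGeometry.Motives.SchemeOver ℂ⦄, Literature.AlgebraicGeometry.Motives.IsSmoothProjective 4 X → ∀ c : Literature.AlgebraicGeometry.HodgeTheory.complexBetti X (2 * 2), Literature.AlgebraicGeometry.HodgeTheory.IsRationalClass c → Literature.AlgebraicGeometry.HodgeTheory.IsOfHodgeType 4 X (2 * 2) 2 2 c → c ∈ Literature.AlgebraicGeometry.HodgeTheory.algebraicClasses X 2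

/-- The crux is literally `K3TypeNets → HC42`. -/
theorem crux_iff :
    Summit.HodgeConjecture.HodgeConjecture.Theses.NoetherLefschetzOneUp.FourfoldsGrantedK3Nets ↔
      (Summit.HodgeConjecture.HodgeConjecture.Theses.NoetherLefschetzOneUp.K3TypeNets → HC42) :=
  Iff.rfl

/-! ## The four registered stubs -/

/-- **Stub 1 `stub_genericGeometricGenus`** — GENERIC CONSTANCY OF THE GEOMETRIC GENUS IN A SURFACE NET (the
route's rank-5 item `GenericGeometricGenus`, stmt-HodgeConjecture-15374, BY NAME): for every smooth projective
complex fourfold `X` and every surface net `N : SurfaceNet 2 X` over `ℙ²` there are a non-empty Zariski-open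
`V` inside the smooth base and ONE `g` such that every fibre over a `ℂ`-point of `V` admits a Hodge model with
`dim H^{2,0} = g`. Why plausibly true: theorem in print (upper semicontinuity of `b ↦ h⁰(S_b, Ω²)`, Hartshorne
III Thm. 12.8; Voisin I Cor. 9.19 / Prop. 9.20). Size: M–L (coherent base change on the tree's carriers). Role:
with the LANDED `Theorems.netReduction_of_generic_geometricGenus` and `Motives.exists_fiberNet_smoothBase_nonempty_holds`
it gives `NetReduction` (every fourfold enters through a net). [cite: Hartshorne1977, III Thm. 12.8]
[cite: VoisinHodgeI2002, §9.3.1 Cor. 9.19 and §9.3.2 Prop. 9.20] -/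
theorem stub_genericGeometricGenus :
    Summit.HodgeConjecture.HodgeConjecture.Theses.NoetherLefschetzOneUp.GenericGeometricGenus :=
  -- LANDED (wave 1, p145296): `Theorems/NoetherLefschetzOneUpFourfoldsGrantedK3NetsStubGenericGeometricGenus.lean`
  -- from `Motives.fiberNet_exists_hasFibreHodgeNumber_holds` (Voisin I Cor. 9.19 / Prop. 9.20, V := the smooth base).
  Summit.HodgeConjecture.HodgeConjecture.Theorems.stub_genericGeometricGenus

/-- **Stub 2 `stub_levelZeroNets`** — LEVEL ZERO, the `g = 0` branch (the route's support item `LevelZeroNets`,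
stmt-HodgeConjecture-11602, BY NAME): for a net whose fibres off a proper closed `T` are smooth projective
surfaces with `h^{2,0} = 0`, `span{rational (2,2)} ≤ algebraic ⊔ vertical`. Why plausibly true: Arapura 2022
Cor. 1.5 (theorem in print; in tree `Theorems.levelZeroNets_of_deligne_smoothPart` from the named facts Deligne
Hodge III Cor. 8.2.8 and Arapura Thm. 1.2 on the smooth part). Size: L. STATE (wave 2, lead c2): CLOSED MODULO
the two named Literature facts below — the body is the LANDED conditional closure
`Theorems.stub_levelZeroNets_of_riemannExistence_of_globalInvariantCycles` (p150363) applied to them; its two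
`sorry`s are, verbatim, `FundamentalGroup.riemannExistence_finiteCovering` (Riemann existence in covering form,
SGA1 XII Thm. 5.1) and `HodgeTheory.deligne_globalInvariantCycles` (théorème de la partie fixe, Hodge II Thm. 4.1.1);
when their `_holds` land in Literature the stub closes by replacing each `sorry` with the `_holds` name.
[cite: Arapura2022, Cor. 1.5] [cite: DeligneHodgeIII1974, Cor. 8.2.8] [cite: SGA1, Exp. XII Thm. 5.1]
[cite: DeligneHodgeII1971, Théorème 4.1.1] -/
theorem stub_levelZeroNets :
    Summit.HodgeConjecture.HodgeConjecture.Theses.NoetherLefschetzOneUp.LevelZeroNets := by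
  refine Summit.HodgeConjecture.HodgeConjecture.Theorems.stub_levelZeroNets_of_riemannExistence_of_globalInvariantCycles
    ?_ ?_
  · -- MISSING NAMED FACT 1: `Literature.AlgebraicGeometry.FundamentalGroup.riemannExistence_finiteCovering`
    -- (SGA1 XII Thm. 5.1, covering form; Literature debt queue — reduced in tree to the normal-affine
    -- "algebraic separating function" statement `riemannExistence_finiteCovering_of_algebraicSeparating`).
    sorry
  · -- MISSING NAMED FACT 2: `Literature.AlgebraicGeometry.HodgeTheory.deligne_globalInvariantCycles`
    -- (Deligne, Hodge II Thm. 4.1.1; Literature debt queue — reductions in `GlobalInvariantCycles*Proofs.lean`).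
    sorry

/-- **Stub 3 `stub_generalTypeNets`** — GENERAL-TYPE NETS = INVERSE MUMFORD ONE LEVEL UP, the `g ≥ 2` branch
(verbatim the retired typed crux `GeneralTypeNets`, stmt-HodgeConjecture-11601; the route's foreseen crux child
`GeneralTypeNetsTyped`): for a net whose fibres off a proper closed `T` are smooth projective surfaces with
`h^{2,0} ≥ 2`, `span{rational (2,2)} ≤ algebraic ⊔ vertical`. Why plausibly true: it is a consequence of the
Hodge conjecture (`pieces_of_hodgeConjecture`). THE HARDEST STUB — open-problem grade: NL curves have expected
codimension `p_g ≥ 2 = dim ℙ²`, so neither density nor a modular audit is available and the supply must come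
from `CH₀` of the generic fibre (Mumford) plus sporadic NL-Gysin classes; modulo the printed NetReduction
(`d ≫ 0` nets) and VerticalHodgeAlgebraic it is HC(4,2) for all fourfolds (refuter sandwich on stmt-11601).
[cite: Mumford1968RatEquiv] [cite: BlochSrinivas1983] [cite: Arapura2022, Cor. 1.4] -/
theorem stub_generalTypeNets :
    ∀ ⦃X : Literature.AlgebraicGeometry.Motives.SchemeOver ℂ⦄ (f : X ⟶ Literature.AlgebraicGeometry.Motives.projectiveSpace 2 ℂ), Literature.AlgebraicGeometry.Motives.IsSmoothProjective 4 X → Function.Surjective f.left.base → (∃ T : Set (Literature.AlgebraicGeometry.Motives.projectiveSpace 2 ℂ).left, IsClosed T ∧ T ≠ Set.univ ∧ ∀ s : Literature.AlgebraicGeometry.Motives.AlgPoints (Literature.AlgebraicGeometry.Motives.projectiveSpace 2 ℂ) ℂ, s.pt ∉ T → Literature.AlgebraicGeometry.Motives.IsSmoothProjective 2 (Literature.AlgebraicGeometry.Motives.fiberOver f s) ∧ ∃ A : Literature.AlgebraicGeometry.HodgeTheory.HodgeModel 2 (Literature.AlgebraicGeometry.Motives.fiberOver f s), 2 ≤ Module.finrank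 ℂ ↥(A.hodgePQ 2 2 0)) → Submodule.span ℂ {c : Literature.AlgebraicGeometry.HodgeTheory.complexBetti X (2 * 2) | Literature.AlgebraicGeometry.HodgeTheory.IsRationalClass c ∧ Literature.AlgebraicGeometry.HodgeTheory.IsOfHodgeType 4 X (2 * 2) 2 2 c} ≤ Literature.AlgebraicGeometry.HodgeTheory.algebraicClasses X 2 ⊔ Submodule.span ℂ {c : Literature.AlgebraicGeometry.HodgeTheory.complexBetti X (2 * 2) | Literature.AlgebraicGeometry.HodgeTheory.IsRationalClass c ∧ Literature.AlgebraicGeometry.HodgeTheory.IsOfHodgeType 4 X (2 * 2) 2 2 c ∧ ∃ T : Set (Literature.AlgebraicGeometry.Motives.projectiveSpace 2 ℂ).left, IsClosed T ∧ T ≠ Set.univ ∧ Literature.AlgebraicGeometry.HodgeTheory.complexBetti.restrictCompl X (f.left.base ⁻¹' T) (2 * 2) c = 0} := by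
  sorry

/-- **Stub 4 `stub_verticalHodgeAlgebraic`** — VERTICAL HODGE CLASSES ON A NETTED FOURFOLD ARE ALGEBRAIC (the
route's support item `VerticalHodgeAlgebraic`, stmt-HodgeConjecture-11603, BY NAME): for `f : X ⟶ ℙ²` surjective
on a smooth projective fourfold, the span of the rational `(2,2)`-classes vanishing on `X ∖ f⁻¹T`, `T ⊊ ℙ²`
closed, lies in `algebraicClasses X 2`. Why plausibly true: theorem in print (Deligne Hodge III Cor. 8.2.8,
semisimplicity of polarisable Hodge structures, Lefschetz (1,1) on resolutions of the components of the
threefold `f⁻¹T`; in tree `Theorems.verticalHodgeAlgebraic_of_lefschetzOneOne`, conditional on the named facts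
Deligne 8.2.8 and Voisin 2025 Cor. 2.12, with `LefschetzOneOne_holds` landed). Size: M.
[cite: DeligneHodgeIII1974, Cor. 8.2.8] [cite: VoisinHodgeII2003] -/
theorem stub_verticalHodgeAlgebraic :
    Summit.HodgeConjecture.HodgeConjecture.Theses.NoetherLefschetzOneUp.VerticalHodgeAlgebraic :=
  -- LANDED (wave 1, p145302): `Theorems/NoetherLefschetzOneUpFourfoldsGrantedK3NetsStubVerticalHodgeAlgebraic.lean`
  -- = `verticalHodgeAlgebraic_of Deligne1974_…_holds Voisin2025_…_holds lefschetzOneOne_rational_holds`.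
  Summit.HodgeConjecture.HodgeConjecture.Theorems.stub_verticalHodgeAlgebraic

/-! ## Sorry-free glue -/

/-- **`NetReduction` from stub 1** (sorry-free): the landed reduction
`Theorems.netReduction_of_generic_geometricGenus` (surface nets on fourfolds with generically constant
geometric genus ⇒ every fourfold enters through a net, algebraicity of rational `(2,2)`-classes descending along
the birational blow-down) fed with the landed net existence `Motives.exists_fiberNet_smoothBase_nonempty_holds`
(`r = m = 2`). [cite: Hartshorne1977, II Example 7.17.3] [cite: VoisinHodgeI2002, §9.3.2 Prop. 9.20] -/
theorem netReduction_of_genericGeometricGenus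
    (hpg : Summit.HodgeConjecture.HodgeConjecture.Theses.NoetherLefschetzOneUp.GenericGeometricGenus) :
    Summit.HodgeConjecture.HodgeConjecture.Theses.NoetherLefschetzOneUp.NetReduction :=
  Summit.HodgeConjecture.HodgeConjecture.Theorems.netReduction_of_generic_geometricGenus
    (fun _ hX => ⟨(Literature.AlgebraicGeometry.Motives.exists_fiberNet_smoothBase_nonempty_holds 2 2
      (by norm_num) hX).choose⟩)
    hpg

/-- **The composition with explicit hypotheses** (the BC3 shape `stub₁-sig → … → stub₄-sig → crux`, with the
crux unfolded one step to `K3TypeNets → HC42` so that `FourfoldsGrantedK3Nets_of` below is the file's only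
theorem headed by the crux name). NET TRICHOTOMY: for a smooth projective fourfold `X`, `NetReduction` (from
`hpg`) gives a netted smooth projective fourfold `f : X' → ℙ²` with fibres off a proper closed `T` smooth of ONE
generic geometric genus `g`, and the transfer `HC(4,2)(X') ⇒ HC(4,2)(X)`; on `X'` the span of the rational
`(2,2)`-classes lies in `algebraic ⊔ vertical` by `hZ` (`g = 0`), by the crux hypothesis `hK3` (`g = 1`) or by
`hG` (`g ≥ 2`), and `hV` makes the vertical summand algebraic. Sorry-free; standard axioms.
[cite: Arapura2022, Cor. 1.4–1.5] [cite: Deligne2000, §1] -/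
theorem hc42_of_pieces
    (hpg : Summit.HodgeConjecture.HodgeConjecture.Theses.NoetherLefschetzOneUp.GenericGeometricGenus)
    (hZ : Summit.HodgeConjecture.HodgeConjecture.Theses.NoetherLefschetzOneUp.LevelZeroNets)
    (hG : GeneralTypeNets)
    (hV : Summit.HodgeConjecture.HodgeConjecture.Theses.NoetherLefschetzOneUp.VerticalHodgeAlgebraic)
    (hK3 : Summit.HodgeConjecture.HodgeConjecture.Theses.NoetherLefschetzOneUp.K3TypeNets) : HC42 := by
  intro X hX
  -- every fourfold enters through a net of constant generic geometric genus `g`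
  obtain ⟨X', f, hX', hf, ⟨T, hT, hTne, g, hfib⟩, htransfer⟩ := netReduction_of_genericGeometricGenus hpg hX
  refine htransfer ?_
  intro c' hc' hpp'
  -- the trichotomy on `g`: rational (2,2)-classes of `X'` are algebraic ⊔ vertical
  have hspan :
      Submodule.span ℂ {c : complexBetti X' (2 * 2) | IsRationalClass c ∧ IsOfHodgeType 4 X' (2 * 2) 2 2 c} ≤
        algebraicClasses X' 2 ⊔ Submodule.span ℂ {c : complexBetti X' (2 * 2) | IsRationalClass c ∧
          IsOfHodgeType 4 X' (2 * 2) 2 2 c ∧ ∃ T : Set (projectiveSpace 2 ℂ).left, IsClosed T ∧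
            T ≠ Set.univ ∧ complexBetti.restrictCompl X' (f.left.base ⁻¹' T) (2 * 2) c = 0} := by
    rcases Nat.lt_trichotomy g 1 with hg | rfl | hg
    · -- `g = 0`: Arapura's level zero
      obtain rfl : g = 0 := Nat.lt_one_iff.mp hg
      exact hZ f hX' hf ⟨T, hT, hTne, hfib⟩
    · -- `g = 1`: the K3-type sector, i.e. the crux's hypothesis
      exact hK3 f hX' hf ⟨T, hT, hTne, hfib⟩
    · -- `g ≥ 2`: general-type nets
      refine hG f hX' hf ⟨T, hT, hTne, fun s hs => ?_⟩
      obtain ⟨h2, A, hA⟩ := hfib s hs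
      exact ⟨h2, A, by omega⟩
  have hmem := hspan (Submodule.subset_span ⟨hc', hpp'⟩)
  -- vertical classes are algebraic
  exact (sup_le le_rfl (hV f hX' hf)) hmem

/-! ## The skeleton theorem: the crux BY NAME from the four declared stubs -/

/-- **THE SKELETON THEOREM.** The crux `Summit.HodgeConjecture.HodgeConjecture.Theses.NoetherLefschetzOneUp.FourfoldsGrantedK3Nets`,
concluded BY NAME from the four DECLARED stubs (the only `sorry`s of the file) through the sorry-free composition
`hc42_of_pieces`; the crux's hypothesis `K3TypeNets` is consumed at the `g = 1` branch. [cite: Deligne2000, §1]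
[cite: Arapura2022, Cor. 1.4–1.5] -/
theorem FourfoldsGrantedK3Nets_of :
    Summit.HodgeConjecture.HodgeConjecture.Theses.NoetherLefschetzOneUp.FourfoldsGrantedK3Nets := by
  intro hK3
  exact hc42_of_pieces stub_genericGeometricGenus stub_levelZeroNets stub_generalTypeNets
    stub_verticalHodgeAlgebraic hK3

/-! ## Sorry-free sanity (documents the converse direction of the BC3 probes) -/

/-- `HC(4,2)` implies the crux (discard `K3TypeNets`). [cite: Deligne2000, §1] -/
theorem crux_of_hc42 (h : HC42) :
    Summit.HodgeConjecture.HodgeConjecture.Theses.NoetherLefschetzOneUp.FourfoldsGrantedK3Nets :=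
  fun _ => h

/-- `HC(4,2)` implies each of the three span statements of the trichotomy (pieces 2, 3 and the K3 sector) and
piece 4, a fortiori: the fibre hypotheses are not used (`Submodule.span_le`, `le_sup_left`). So pieces 2–4 are
irrefutable short of a rational `(2,2)` counterexample to the Hodge conjecture on a fourfold; the risk of the
line is hardness, concentrated in `stub_generalTypeNets`. [cite: Deligne2000, §1] -/
theorem pieces_of_hc42 (h : HC42) :
    Summit.HodgeConjecture.HodgeConjecture.Theses.NoetherLefschetzOneUp.LevelZeroNets ∧ GeneralTypeNets ∧
      Summit.HodgeConjecture.HodgeConjecture.Theses.NoetherLefschetzOneUp.VerticalHodgeAlgebraic ∧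
      Summit.HodgeConjecture.HodgeConjecture.Theses.NoetherLefschetzOneUp.K3TypeNets := by
  refine ⟨?_, ?_, ?_, ?_⟩
  · intro X f hX _ _
    exact le_sup_of_le_left (Submodule.span_le.mpr fun c hc ↦ h hX c hc.1 hc.2)
  · intro X f hX _ _
    exact le_sup_of_le_left (Submodule.span_le.mpr fun c hc ↦ h hX c hc.1 hc.2)
  · intro X f hX _
    exact Submodule.span_le.mpr fun c hc ↦ h hX c hc.1 hc.2.1
  · intro X f hX _ _
    exact le_sup_of_le_left (Submodule.span_le.mpr fun c hc ↦ h hX c hc.1 hc.2)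

/-- The summit implies `HC(4,2)`, hence the crux and pieces 2–4. [cite: Deligne2000, §1] -/
theorem pieces_of_hodgeConjecture (h : _root_.HodgeConjecture) :
    HC42 ∧ Summit.HodgeConjecture.HodgeConjecture.Theses.NoetherLefschetzOneUp.FourfoldsGrantedK3Nets ∧
      Summit.HodgeConjecture.HodgeConjecture.Theses.NoetherLefschetzOneUp.LevelZeroNets ∧ GeneralTypeNets ∧
      Summit.HodgeConjecture.HodgeConjecture.Theses.NoetherLefschetzOneUp.VerticalHodgeAlgebraic ∧
      Summit.HodgeConjecture.HodgeConjecture.Theses.NoetherLefschetzOneUp.K3TypeNets := by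
  have h42 : HC42 := fun X hX c hc hpp => (h hX).2 2 c hc hpp
  exact ⟨h42, crux_of_hc42 h42, pieces_of_hc42 h42⟩

end Summit.HodgeConjecture.HodgeConjecture.Cruxes.FourfoldsGrantedK3Nets.Birth

end
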